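import Literature.NumberTheory.Transcendental.RoySmallValueEstimatesNotInProofs
import HarnessLib

/-!
# Small value estimates at rational translates (Nguyen–Roy 2016) — proofs, XXI: conjugacy classes of algebraic points

Twenty-first proofs file towards `Literature.NumberTheory.Transcendental.nguyenRoy2016_thm_1` (Nguyen–Roy,
IJNT 12 (2016) = arXiv:1412.5163). Everything here is PROVED; no named facts. The zero-dimensional
`ℚ`-subvarieties of `ℙ²` of §4 of the paper are the sets of conjugates `conj P` of algebraic
points `P` (file XVI). This file shows that these sets behave as the classes of an equivalence
relation — the fact behind "distinct subvarieties are disjoint" and behind the sums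
`∑ᵢ deg(τⁱZ) ≤ deg(W)`, `∑ᵢ h(τⁱZ) ≤ h(W)` over distinct subvarieties contained in a finite `W`
in the proof of **Proposition 14**:

* `conj_subset_conj_embPt` — `conj P ⊆ conj (φ(P))` (through a `ℚ`-algebra map
  `G : ℚ(φ(P)) → ℚ(P)` with `φ ∘ G = id`, built by choice from `ℚ(φ(P)) ⊆ φ(ℚ(P))`), whence by
  counting dimensions (`#conj = [ℚ(·):ℚ]`) `G` is an isomorphism and
  **`conj_embPt : conj (φ(P)) = conj P`**;
* **`conj_eq_of_mem_conj`** (`q ∈ conj P ⟹ conj q = conj P`), `conj_eq_or_disjoint` (two classes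
  are equal or disjoint), `deg_eq_of_mem_conj`, `ht_eq_of_mem_conj`, `ht_eq_sum_habs`
  (`ht P = ∑_{q ∈ conj P} h_abs(q)`);
* `sum_card_conj_le_card`, `sum_sum_conj_le_sum` — for a finite family of algebraic points with
  pairwise distinct classes contained in a finite `W ⊆ ℙ²(ℂ)`: `∑ #conj ≤ #W` and
  `∑_Z ∑_{α ∈ conj Z} f(α) ≤ ∑_{α ∈ W} f(α)` for `f ≥ 0` on `W`.

## References

* [NguyenRoy2016] N. A. V. Nguyen, D. Roy, IJNT 12 (2016) 1273–1293 = arXiv:1412.5163, §4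
  (zero-dimensional subvarieties), §5, proof of Proposition 14 ("As they are contained in `W`, we
  conclude that `∑ deg(τⁱ(Z)) ≤ deg(W)` and `∑ h(τⁱ(Z)) ≤ h(W)`").
-/

noncomputable section

open Height Module Finset
open scoped Classical

namespace Literature.NumberTheory.Transcendental

namespace NguyenRoy

namespace AlgPt

variable (P : AlgPt)

/-- The conjugate as an algebraic point. [folklore] -/
def conjPt (φ : Kp P.1 →ₐ[ℚ] ℂ) : AlgPt := ⟨P.embPt φ, ⟨P.presConj φ⟩⟩

/-- `(conjPt φ : ℙ²) = φ(P)`. [folklore] -/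
@[simp] theorem conjPt_val (φ : Kp P.1 →ₐ[ℚ] ℂ) : (P.conjPt φ).1 = P.embPt φ := rfl

/-- `ℚ(φ(P)) ⊆ φ(ℚ(P))`: every element of `ℚ(φ(P))` is `φ(x)` for some `x ∈ ℚ(P)`. [folklore] -/
theorem exists_eq_of_mem_Kp_embPt (φ : Kp P.1 →ₐ[ℚ] ℂ) (y : Kp (P.embPt φ)) :
    ∃ x : Kp P.1, φ x = (y : ℂ) := by
  have hle : Kp (P.embPt φ) ≤ φ.fieldRange := by
    refine IntermediateField.adjoin_le_iff.mpr ?_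
    rintro _ ⟨j, rfl⟩
    rw [P.nv_embPt φ]
    exact ⟨ap P.1 j, rfl⟩
  exact hle y.2

/-- **A right inverse `G : ℚ(φ(P)) → ℚ(P)` of `φ`** (a `ℚ`-algebra homomorphism with `φ ∘ G = id`).
[folklore] -/
theorem exists_rightInverse_algHom (φ : Kp P.1 →ₐ[ℚ] ℂ) :
    ∃ G : Kp (P.embPt φ) →ₐ[ℚ] Kp P.1, ∀ y, φ (G y) = (y : ℂ) := by
  choose g hg using P.exists_eq_of_mem_Kp_embPt φ
  have hinj : Function.Injective φ := φ.toRingHom.injective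
  refine ⟨{ toFun := g
            map_one' := hinj (by rw [hg, map_one]; rfl)
            map_mul' := fun a b => hinj (by rw [hg, map_mul, hg, hg]; rfl)
            map_zero' := hinj (by rw [hg, map_zero]; rfl)
            map_add' := fun a b => hinj (by rw [hg, map_add, hg, hg]; rfl)
            commutes' := fun c => hinj ?_ }, fun y => hg y⟩
  rw [hg, AlgHom.commutes]
  simp

/-- **`conj P ⊆ conj (φ(P))`.** [cite: NguyenRoy2016, §4] -/
theorem conj_subset_conj_conjPt (φ : Kp P.1 →ₐ[ℚ] ℂ) : P.conj ⊆ (P.conjPt φ).conj := by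
  obtain ⟨G, hG⟩ := P.exists_rightInverse_algHom φ
  have hGap : ∀ j, G (ap (P.embPt φ) j) = ap P.1 j := fun j => φ.toRingHom.injective (by
    change φ (G _) = φ _
    rw [hG, coe_ap, P.nv_embPt φ])
  intro q hq
  obtain ⟨ψ, -, rfl⟩ := Finset.mem_image.mp hq
  refine Finset.mem_image.mpr ⟨ψ.comp G, Finset.mem_univ _, mk_congr _ _ (funext fun j => ?_)⟩
  change ψ (G (ap (P.embPt φ) j)) = ψ (ap P.1 j)
  rw [hGap]

/-- **Conjugates have the same conjugates**: `conj (φ(P)) = conj P`. [cite: NguyenRoy2016, §4] -/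
theorem conj_conjPt (φ : Kp P.1 →ₐ[ℚ] ℂ) : (P.conjPt φ).conj = P.conj := by
  obtain ⟨G, hG⟩ := P.exists_rightInverse_algHom φ
  have hGinj : Function.Injective G := fun a b h => Subtype.ext (by rw [← hG a, ← hG b, h])
  have hGap : ∀ j, G (ap (P.embPt φ) j) = ap P.1 j := fun j => φ.toRingHom.injective (by
    change φ (G _) = φ _
    rw [hG, coe_ap, P.nv_embPt φ])
  -- dimension count: `[ℚ(φP):ℚ] ≤ [ℚ(P):ℚ]` by `G`, `≥` by `conj P ⊆ conj (φP)`
  have h1 : (P.conjPt φ).deg ≤ P.deg := LinearMap.finrank_le_finrank_of_injective (f := G.toLinearMap) hGinj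
  have h2 : P.deg ≤ (P.conjPt φ).deg := by
    rw [← P.card_conj, ← (P.conjPt φ).card_conj]
    exact Finset.card_le_card (P.conj_subset_conj_conjPt φ)
  have hdeg : (P.conjPt φ).deg = P.deg := le_antisymm h1 h2
  have hGsurj : Function.Surjective G :=
    (LinearMap.injective_iff_surjective_of_finrank_eq_finrank hdeg (f := G.toLinearMap)).mp hGinj
  -- the two classes
  refine Finset.Subset.antisymm ?_ (P.conj_subset_conj_conjPt φ)
  intro q hq
  obtain ⟨χ, -, rfl⟩ := Finset.mem_image.mp hq
  let e : Kp (P.embPt φ) ≃ₐ[ℚ] Kp P.1 := AlgEquiv.ofBijective G ⟨hGinj, hGsurj⟩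
  refine Finset.mem_image.mpr ⟨χ.comp e.symm.toAlgHom, Finset.mem_univ _,
    mk_congr _ _ (funext fun j => ?_)⟩
  change χ (e.symm (ap P.1 j)) = χ (ap (P.embPt φ) j)
  congr 1
  exact e.symm_apply_eq.mpr (hGap j).symm

/-- **`q ∈ conj P ⟹ conj q = conj P`.** [cite: NguyenRoy2016, §4] -/
theorem conj_eq_of_mem_conj {Q : AlgPt} (hQ : Q.1 ∈ P.conj) : Q.conj = P.conj := by
  obtain ⟨φ, -, hφ⟩ := Finset.mem_image.mp hQ
  have hQP : Q = P.conjPt φ := Subtype.ext hφ.symm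
  rw [hQP]
  exact P.conj_conjPt φ

/-- **Two classes of conjugates are equal or disjoint.** [cite: NguyenRoy2016, §4] -/
theorem conj_eq_or_disjoint (P' : AlgPt) : P.conj = P'.conj ∨ Disjoint P.conj P'.conj := by
  by_cases h : Disjoint P.conj P'.conj
  · exact Or.inr h
  · left
    obtain ⟨q, hq, hq'⟩ := Finset.not_disjoint_iff.mp h
    have hqa : IsAlgPt q := P.isAlgPt_of_mem_conj hq
    rw [← P.conj_eq_of_mem_conj (Q := ⟨q, hqa⟩) hq, ← P'.conj_eq_of_mem_conj (Q := ⟨q, hqa⟩) hq']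

/-- Conjugate points have the same degree. [cite: NguyenRoy2016, §4] -/
theorem deg_eq_of_mem_conj {Q : AlgPt} (hQ : Q.1 ∈ P.conj) : Q.deg = P.deg := by
  rw [← Q.card_conj, ← P.card_conj, P.conj_eq_of_mem_conj hQ]

/-- Conjugate points have the same height `ht = deg · h_abs`. [cite: NguyenRoy2016, §4] -/
theorem ht_eq_of_mem_conj {Q : AlgPt} (hQ : Q.1 ∈ P.conj) : Q.ht = P.ht := by
  rw [ht, ht, P.deg_eq_of_mem_conj hQ, P.habs_of_mem_conj hQ]

/-- The height of a class as a sum over its points: `ht P = ∑_{q ∈ conj P} h_abs(q)`.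
[cite: NguyenRoy2016, §4] -/
theorem ht_eq_sum_habs : P.ht = ∑ q ∈ P.conj, habs q := by
  rw [Finset.sum_congr rfl fun q hq => P.habs_of_mem_conj hq, Finset.sum_const, P.card_conj,
    nsmul_eq_mul, AlgPt.ht]

end AlgPt

/-! ### Sums over distinct classes inside a finite set -/

/-- **Distinct classes inside a finite set `W`**: for a finite family of algebraic points with
pairwise distinct classes all contained in `W`, `∑ #conj ≤ #W`.
[cite: NguyenRoy2016, §5, proof of Proposition 14 ("∑ deg(τⁱ(Z)) ≤ deg(W)")] -/
theorem sum_card_conj_le_card {ι : Type*} (s : Finset ι) (Z : ι → AlgPt) (W : Finset PPt)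
    (hdist : ∀ i ∈ s, ∀ j ∈ s, i ≠ j → (Z i).conj ≠ (Z j).conj) (hW : ∀ i ∈ s, (Z i).conj ⊆ W) :
    ∑ i ∈ s, ((Z i).conj).card ≤ W.card := by
  rw [← Finset.card_biUnion]
  · exact Finset.card_le_card (Finset.biUnion_subset.mpr hW)
  · intro i hi j hj hij
    rcases (Z i).conj_eq_or_disjoint (Z j) with h | h
    · exact absurd h (hdist i hi j hj hij)
    · exact h

/-- **Sums over distinct classes inside `W`**: for `f ≥ 0` on `W`,
`∑_Z ∑_{α ∈ conj Z} f(α) ≤ ∑_{α ∈ W} f(α)`.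
[cite: NguyenRoy2016, §5, proof of Proposition 14 ("∑ h(τⁱ(Z)) ≤ h(W)")] -/
theorem sum_sum_conj_le_sum {ι : Type*} (s : Finset ι) (Z : ι → AlgPt) (W : Finset PPt)
    (hdist : ∀ i ∈ s, ∀ j ∈ s, i ≠ j → (Z i).conj ≠ (Z j).conj) (hW : ∀ i ∈ s, (Z i).conj ⊆ W)
    (f : PPt → ℝ) (hf : ∀ a ∈ W, 0 ≤ f a) :
    ∑ i ∈ s, ∑ a ∈ (Z i).conj, f a ≤ ∑ a ∈ W, f a := by
  rw [← Finset.sum_biUnion]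
  · exact Finset.sum_le_sum_of_subset_of_nonneg (Finset.biUnion_subset.mpr hW)
      fun a ha _ => hf a ha
  · intro i hi j hj hij
    rcases (Z i).conj_eq_or_disjoint (Z j) with h | h
    · exact absurd h (hdist i hi j hj hij)
    · exact h

end NguyenRoy

end Literature.NumberTheory.Transcendental

end
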